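import Mathlib
import Literature.AlgebraicGeometry.Resolution.PowerSeriesCleaning
import Literature.AlgebraicGeometry.Resolution.FormalCoordinateChange

/-!
# `WeightedInvariant.WeightedConstruction`, line `weighted-oblique-fuel`: cleaned order is stable

Route `ResolutionOfSingularities/WeightedInvariant`, crux `WeightedConstruction`
(stmt-ResolutionOfSingularities-0571), stub `stub_cleanOrderStable` of the lead's skeleton
`work/WeightedConstruction.lean`, PROVED here (statement verbatim from the ledger registration).

**Statement (CLEANED ORDER IS A COORDINATE-FREE INVARIANT).** Let `k` be a field of characteristic
`p`, `q = pᵉ`, and let `G ∈ k[[x₁, …, xₘ]]` be CLEAN: no monomial of `G` has all its exponents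
divisible by `q` (Hauser–Perlega purely inseparable setting `f = z^q + G(x)`).  Let `θ` be a formal
coordinate change (`θᵢ ∈ 𝔪`, invertible linear part `A = (∂θᵢ/∂xⱼ(0))`).  Then re-cleaning the
transported series does not change the order: `ord (qClean q (G ∘ θ)) = ord G`.

**Proof.** Put `ν = ord G` (the case `G = 0` is trivial).
* Lower bound: `ord (G ∘ θ) ≥ ν` (`MvPowerSeries.le_order_subst`, the `θᵢ` have no constant term) and
  cleaning only deletes monomials, so `ord (qClean q (G ∘ θ)) ≥ ν`.
* Upper bound: suppose every degree-`ν` coefficient of `qClean q (G ∘ θ)` vanished, i.e. every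
  degree-`ν` monomial of `G ∘ θ` were a `q`-th-power monomial.  Factor `θ = ψ ∘ A` with `ψ` tangent to
  the identity (`FormalCoordChange.subst_eq_subst_normalize`); `ψ` does not alter the coefficients of
  lowest degree (`TangentId.coeff_subst_of_degree_le`), and in degree `ν` the linear substitution `A`
  only sees the initial form `G_ν` (the remainder `G - G_ν` has order `> ν`, preserved by substitution).
  So the degree-`ν` part `P_ν` of `G_ν ∘ A` would have `q`-th-power support.  FROBENIUS: a series with
  `q`-th-power support is `expand_q F'`, and `(expand_q F') ∘ A = expand_q (F' ∘ A^{(q)})` because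
  `(Σⱼ aⱼ xⱼ)^q = Σⱼ aⱼ^q xⱼ^q` in characteristic `p` (`sum_pow_char_pow`, `MvPowerSeries.expand_subst`);
  hence `q`-th-power support is preserved by linear substitutions, and applying `A⁻¹`
  (`FormalCoordChange.subst_linSubst_linSubst`) shows that `G_ν` itself has `q`-th-power support in
  degree `ν`.  Cleanness of `G` then forces `G_ν = 0`, contradicting `ν = ord G`
  (`MvPowerSeries.homogeneousComponent_of_order`).
-/

set_option linter.dupNamespace false -- mandated namespace of this single-conjunct summit

namespace Summit.ResolutionOfSingularities.ResolutionOfSingularities.Theorems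

open Literature.AlgebraicGeometry.Resolution

/-- A substitution by series without constant terms does not lower the order. -/
private theorem order_le_order_subst {k : Type*} [Field k] {n : ℕ} {τ : Type*}
    (a : Fin n → MvPowerSeries τ k) (ha : ∀ i, MvPowerSeries.constantCoeff (a i) = 0)
    (F : MvPowerSeries (Fin n) k) : F.order ≤ (MvPowerSeries.subst a F).order := by
  have h1 : (1 : ℕ∞) ≤ ⨅ i, (a i).order :=
    le_iInf fun i => (MvPowerSeries.one_le_order_iff_constCoeff_eq_zero).mpr (ha i)
  calc F.order = 1 * F.order := (one_mul _).symm
    _ ≤ (⨅ i, (a i).order) * F.order := mul_le_mul' h1 le_rfl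
    _ ≤ _ := MvPowerSeries.le_order_subst (MvPowerSeries.hasSubst_of_constantCoeff_zero ha) F

/-- Cleaning (deleting monomials) does not lower the order. -/
private theorem order_le_order_qClean {σ K : Type*} [Semiring K] (q : ℕ) (F : MvPowerSeries σ K) :
    F.order ≤ (qClean q F).order := by
  refine MvPowerSeries.le_order fun d hd => ?_
  by_cases h : ∀ l, q ∣ d l
  · exact coeff_qClean_of_dvd q F h
  · rw [coeff_qClean_of_not_dvd q F h]
    exact MvPowerSeries.coeff_of_lt_order hd

/-- The components of a linear substitution have no constant term. -/
private theorem constantCoeff_linSubst {k : Type*} [Field k] {n : ℕ} (M : Matrix (Fin n) (Fin n) k)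
    (i : Fin n) : MvPowerSeries.constantCoeff (FormalCoordChange.linSubst M i) = 0 := by
  simp [FormalCoordChange.linSubst, map_sum, MvPowerSeries.constantCoeff_X]

/-- In degree `ν ≤ ord F` the coefficients of `subst a F` (with `aᵢ ∈ 𝔪`) only depend on the
degree-`ν` homogeneous component of `F`: the remainder has order `> ν`, and so has its image. -/
private theorem coeff_subst_eq_coeff_subst_homogeneousComponent {k : Type*} [Field k] {n : ℕ}
    {τ : Type*} (a : Fin n → MvPowerSeries τ k)
    (ha : ∀ i, MvPowerSeries.constantCoeff (a i) = 0) (F : MvPowerSeries (Fin n) k) {ν : ℕ}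
    (hν : (ν : ℕ∞) ≤ F.order) (α : τ →₀ ℕ) (hα : α.degree = ν) :
    MvPowerSeries.coeff α (MvPowerSeries.subst a F) =
      MvPowerSeries.coeff α (MvPowerSeries.subst a (MvPowerSeries.homogeneousComponent ν F)) := by
  have has : MvPowerSeries.HasSubst a := MvPowerSeries.hasSubst_of_constantCoeff_zero ha
  have hrem : ((ν + 1 : ℕ) : ℕ∞) ≤ (F - MvPowerSeries.homogeneousComponent ν F).order := by
    refine MvPowerSeries.nat_le_order fun d hd => ?_
    rw [map_sub, MvPowerSeries.coeff_homogeneousComponent]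
    by_cases hdeg : d.degree = ν
    · rw [if_pos hdeg, sub_self]
    · rw [if_neg hdeg, sub_zero]
      have hlt : d.degree < ν := by omega
      exact MvPowerSeries.coeff_of_lt_order (lt_of_lt_of_le (by exact_mod_cast hlt) hν)
  have hzero : MvPowerSeries.coeff α
      (MvPowerSeries.subst a (F - MvPowerSeries.homogeneousComponent ν F)) = 0 := by
    apply MvPowerSeries.coeff_of_lt_order
    refine lt_of_lt_of_le ?_ (hrem.trans (order_le_order_subst a ha _))
    rw [hα]
    exact_mod_cast Nat.lt_succ_self ν
  rwa [MvPowerSeries.subst_sub has, map_sub, sub_eq_zero] at hzero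

/-- FROBENIUS STEP: in characteristic `p`, a series all of whose monomials are `pᵉ`-th-power
monomials keeps this property under any linear substitution `xᵢ ↦ Σⱼ Mᵢⱼ xⱼ`, because
`F = expand_{pᵉ} F'` and `(Σⱼ Mᵢⱼ xⱼ)^{pᵉ} = Σⱼ Mᵢⱼ^{pᵉ} xⱼ^{pᵉ}`, so that
`F ∘ M = expand_{pᵉ} (F' ∘ M^{(pᵉ)})`. -/
private theorem coeff_subst_linSubst_eq_zero_of_not_dvd {p : ℕ} (hp : p.Prime) {k : Type*}
    [Field k] [CharP k p] (e : ℕ) {n : ℕ} (M : Matrix (Fin n) (Fin n) k)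
    (F : MvPowerSeries (Fin n) k)
    (hF : ∀ α : Fin n →₀ ℕ, (¬ ∀ l, p ^ e ∣ α l) → MvPowerSeries.coeff α F = 0)
    (α : Fin n →₀ ℕ) (hα : ¬ ∀ l, p ^ e ∣ α l) :
    MvPowerSeries.coeff α (MvPowerSeries.subst (FormalCoordChange.linSubst M) F) = 0 := by
  classical
  haveI : ExpChar k p := ExpChar.prime hp
  haveI : ExpChar (MvPowerSeries (Fin n) k) p :=
    expChar_of_injective_ringHom MvPowerSeries.C_injective p
  have hq0 : p ^ e ≠ 0 := pow_ne_zero e hp.ne_zero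
  -- `F = expand_{p^e} F'`
  obtain ⟨F', hexp⟩ : ∃ F' : MvPowerSeries (Fin n) k, F = MvPowerSeries.expand (p ^ e) hq0 F' := by
    refine ⟨fun β => MvPowerSeries.coeff ((p ^ e) • β) F, ?_⟩
    ext β
    by_cases hβ : ∀ l, p ^ e ∣ β l
    · obtain ⟨γ, hγ⟩ : ∃ γ : Fin n →₀ ℕ, (p ^ e) • γ = β :=
        ⟨β.mapRange (fun a => a / p ^ e) (by simp), by
          ext i; simp [Nat.mul_div_cancel' (hβ i)]⟩
      rw [← hγ, MvPowerSeries.coeff_expand_smul]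
      rfl
    · push Not at hβ
      obtain ⟨i, hi⟩ := hβ
      rw [MvPowerSeries.coeff_expand_of_not_dvd (p ^ e) hq0 _ hi, hF β (fun h => hi (h i))]
  have hM : MvPowerSeries.HasSubst (FormalCoordChange.linSubst M) :=
    FormalCoordChange.hasSubst_linSubst M
  -- `(expand F') ∘ M = F' ∘ (M-linear forms)^{p^e}`
  have hcomp : MvPowerSeries.subst (FormalCoordChange.linSubst M)
      (MvPowerSeries.expand (p ^ e) hq0 F') =
      MvPowerSeries.subst (fun s => FormalCoordChange.linSubst M s ^ p ^ e) F' := by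
    rw [MvPowerSeries.expand, MvPowerSeries.substAlgHom_apply,
      MvPowerSeries.subst_comp_subst_apply (MvPowerSeries.HasSubst.X_pow hq0) hM]
    congr 1
    funext s
    simp only [MvPowerSeries.subst_pow hM, MvPowerSeries.subst_X hM]
  -- Frobenius on linear forms
  have hlin : (fun s => FormalCoordChange.linSubst M s ^ p ^ e) = fun s =>
      MvPowerSeries.expand (p ^ e) hq0
        (FormalCoordChange.linSubst (M.map fun x => x ^ p ^ e) s) := by
    funext s
    simp only [FormalCoordChange.linSubst]
    rw [sum_pow_char_pow p e, map_sum]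
    refine Finset.sum_congr rfl fun j _ => ?_
    rw [smul_pow, map_smul, MvPowerSeries.expand_X, Matrix.map_apply]
  rw [hexp, hcomp, hlin, ← MvPowerSeries.expand_subst (p ^ e) hq0
    (FormalCoordChange.hasSubst_linSubst _)]
  push Not at hα
  obtain ⟨i, hi⟩ := hα
  exact MvPowerSeries.coeff_expand_of_not_dvd (p ^ e) hq0 _ hi

/-- CLEANED ORDER IS STABLE: for a clean series `G` (no `pᵉ`-th-power monomials) over a field of
characteristic `p` and a formal coordinate change `θ` (no constant terms, invertible linear part),
`ord (qClean (p^e) (G ∘ θ)) = ord G`. -/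
theorem stub_cleanOrderStable : ∀ (p : ℕ), p.Prime → ∀ (k : Type) [Field k] [CharP k p] (e m : ℕ) (G : MvPowerSeries (Fin m) k), (∀ α : Fin m →₀ ℕ, (∀ l, p ^ e ∣ α l) → MvPowerSeries.coeff α G = 0) → ∀ (θ : Fin m → MvPowerSeries (Fin m) k), (∀ i, MvPowerSeries.constantCoeff (θ i) = 0) → IsUnit (Matrix.det (Matrix.of fun i j => MvPowerSeries.coeff (Finsupp.single j 1) (θ i))) → (qClean (p ^ e) (MvPowerSeries.subst θ G)).order = G.order := by
  intro p hp k _ _ e m G hclean θ hθ0 hdet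
  classical
  have hdet' : IsUnit (FormalCoordChange.linMat θ).det := hdet
  have hasθ : MvPowerSeries.HasSubst θ := MvPowerSeries.hasSubst_of_constantCoeff_zero hθ0
  -- the zero series
  by_cases hG : G = 0
  · subst hG
    have h0 : MvPowerSeries.subst θ (0 : MvPowerSeries (Fin m) k) = 0 := by
      rw [← MvPowerSeries.coe_substAlgHom hasθ, map_zero]
    rw [h0, qClean_zero]
  -- `ν = ord G`
  obtain ⟨ν, hν⟩ : ∃ ν : ℕ, G.order = ν :=
    ⟨G.order.toNat, (MvPowerSeries.ne_zero_iff_order_finite.mp hG).symm⟩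
  rw [hν]
  refine le_antisymm ?_ ?_
  · -- upper bound, by contradiction
    by_contra hlt
    push Not at hlt
    have hvan : ∀ α : Fin m →₀ ℕ, α.degree = ν → (¬ ∀ l, p ^ e ∣ α l) →
        MvPowerSeries.coeff α (MvPowerSeries.subst θ G) = 0 := by
      intro α hα hndvd
      rw [← coeff_qClean_of_not_dvd (p ^ e) _ hndvd]
      exact MvPowerSeries.coeff_of_lt_order (by rw [hα]; exact hlt)
    -- the linear part `L` and the factorisation `θ = ψ ∘ L`
    set L := FormalCoordChange.linMat θ with hL
    have hL0 := constantCoeff_linSubst L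
    set F₁ := MvPowerSeries.subst (FormalCoordChange.linSubst L) G with hF₁
    have hνF₁ : (ν : ℕ∞) ≤ F₁.order := hν ▸ order_le_order_subst _ hL0 G
    have hcoeff1 : ∀ α : Fin m →₀ ℕ, α.degree = ν →
        MvPowerSeries.coeff α (MvPowerSeries.subst θ G) = MvPowerSeries.coeff α F₁ := by
      intro α hα
      rw [FormalCoordChange.subst_eq_subst_normalize hθ0 hdet' G]
      exact (FormalCoordChange.tangentId_normalize hθ0 hdet').coeff_subst_of_degree_le F₁ α
        (by rw [hα]; exact hνF₁)
    -- the initial form `G_ν` and its image `P`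
    set Gν := MvPowerSeries.homogeneousComponent ν G with hGν
    have hGν0 : Gν ≠ 0 := MvPowerSeries.homogeneousComponent_of_order hν.symm
    have hνGν : (ν : ℕ∞) ≤ Gν.order :=
      MvPowerSeries.nat_le_order fun d hd => by
        rw [hGν, MvPowerSeries.coeff_homogeneousComponent, if_neg hd.ne]
    set P := MvPowerSeries.subst (FormalCoordChange.linSubst L) Gν with hP
    have hcoeff2 : ∀ α : Fin m →₀ ℕ, α.degree = ν →
        MvPowerSeries.coeff α F₁ = MvPowerSeries.coeff α P := fun α hα =>
      coeff_subst_eq_coeff_subst_homogeneousComponent _ hL0 G hν.ge α hα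
    have hνP : (ν : ℕ∞) ≤ P.order := hνGν.trans (order_le_order_subst _ hL0 Gν)
    -- the degree-`ν` part of `P` has `q`-th-power support
    set Pν := MvPowerSeries.homogeneousComponent ν P with hPν
    have hPνq : ∀ α : Fin m →₀ ℕ, (¬ ∀ l, p ^ e ∣ α l) → MvPowerSeries.coeff α Pν = 0 := by
      intro α hndvd
      rw [hPν, MvPowerSeries.coeff_homogeneousComponent]
      split_ifs with hα
      · rw [← hcoeff2 α hα, ← hcoeff1 α hα]
        exact hvan α hα hndvd
      · rfl
    -- transport back along `L⁻¹`
    have hback : MvPowerSeries.subst (FormalCoordChange.linSubst L⁻¹) P = Gν := by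
      rw [hP, FormalCoordChange.subst_linSubst_linSubst, Matrix.mul_nonsing_inv _ hdet',
        FormalCoordChange.linSubst_one, MvPowerSeries.subst_self]
      rfl
    have hcoeff3 : ∀ α : Fin m →₀ ℕ, α.degree = ν → MvPowerSeries.coeff α Gν =
        MvPowerSeries.coeff α (MvPowerSeries.subst (FormalCoordChange.linSubst L⁻¹) Pν) := by
      intro α hα
      rw [← hback]
      exact coeff_subst_eq_coeff_subst_homogeneousComponent _ (constantCoeff_linSubst L⁻¹) P
        hνP α hα
    -- hence `G_ν = 0`: contradiction
    refine hGν0 ?_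
    ext α
    rw [MvPowerSeries.coeff_zero]
    by_cases hα : α.degree = ν
    · by_cases hdvd : ∀ l, p ^ e ∣ α l
      · rw [hGν, MvPowerSeries.coeff_homogeneousComponent, if_pos hα]
        exact hclean α hdvd
      · rw [hcoeff3 α hα]
        exact coeff_subst_linSubst_eq_zero_of_not_dvd hp e L⁻¹ Pν hPνq α hdvd
    · rw [hGν, MvPowerSeries.coeff_homogeneousComponent, if_neg hα]
  · -- lower bound
    calc (ν : ℕ∞) = G.order := hν.symm
      _ ≤ (MvPowerSeries.subst θ G).order := order_le_order_subst θ hθ0 G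
      _ ≤ _ := order_le_order_qClean _ _

end Summit.ResolutionOfSingularities.ResolutionOfSingularities.Theorems
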